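import Mathlib
import Summits.KontsevichZagierPeriods.Zeta5Search.FlagRayCellsA
import Summits.KontsevichZagierPeriods.Zeta5Search.FlagRayCellsB
import Summits.KontsevichZagierPeriods.Zeta5Search.FlagRayCellsC
import Summits.KontsevichZagierPeriods.Zeta5Search.FlagRayCellsD
import Summits.KontsevichZagierPeriods.Zeta5Search.FlagRayCellsE
import Summits.KontsevichZagierPeriods.Zeta5Search.FlagRayCellsF
import Summits.KontsevichZagierPeriods.Zeta5Search.FlagRayCellsG
import Summits.KontsevichZagierPeriods.Zeta5Search.FlagRayCellsH
import Summits.KontsevichZagierPeriods.Zeta5Search.StairCellFLAGa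
import HarnessLib

/-!
# ζ(5) search — the Casoratian class bound `casLB` on EVERY first-period θ-cell of the band-60 FLAG ray, all `n` (part 1: the cells)

Cell `pub-zeta5` (HONEST FRAMING: systematic search; no irrationality claim unless certified), TRACK «DENOM-LAW» D1 prover seat
(denom-prover-d1 g12, `HOME/denom-law/prover-d1/ATTEMPT-12.md`).  On the band-60 FLAG ray `b(n) = n·(60; 25,24,22,21,19,18,16)`
(`bRay [60,25,24,22,21,19,18,16] n`; direction `(11,24,14,22,17,23,26,19)`, `d = 35n`; first period ⟺ `p > 13n`) the class-type covers of
`FlagRayCellsA–H` give the EXACT value of the tree's Casoratian class bound on each θ-cell (`θ = p/n`):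
`casLB ≥ −11, −9, −9, −7, −6, −6, −6, −5, −5, −3, −1, 0, 1, 0` on `(13,14], (14,15], (15,16], (16,17], (17,17.5], (17.5,18], (18,19], (19,20],
(20,21], (22,23], (23,25], (25,26], (26,35], (35,60]` (all attained: brute force `n ≤ 12`), and `casLB ≥ 0` beyond the support (`p > 60n`, singleton
classes).  With the closed forms of `N_p` (`pairFloors_flag`) and of the refund this yields the DOMINANCE `refund − N_p ≤ casLB` at every prime
`p > 13n` OFF the band `21n < p < 22n` (there `casLB = −5 < −4 = refund − N_p`; the band is the tree's `StairCellFLAGa`, double-drop bonus), and hence —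
`FlagRayCV` below — (CV) `v_p(Cas_j(b(n))) ≥ refund − N_p` for every `n ≥ 1`, every `1 ≤ j ≤ 7` and every prime `p > 13n` (THEOREM LB
`casoratianClassBound_holds`; on the band the double-drop bonus read `j`-generically from the tree's cover `StairFLAG.cover_a`).
MODEL/structure-side integer bookkeeping on the cell's own class data; nothing about ζ(5); no γ; records in print UNMOVED.
-/

open Finset

namespace Summit.KontsevichZagierPeriods.Zeta5Search.StairFLAG

open Summit.KontsevichZagierPeriods.Zeta5Search.ClusterValuation
open Summit.KontsevichZagierPeriods.Zeta5Search.CasoratianValuation (InPolytope shift casoratian pairFloors refund)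
open Summit.KontsevichZagierPeriods.Zeta5Search.WedgeDictionary (dOf)
open Summit.KontsevichZagierPeriods.Zeta5Search.ClassTypeCover
open Summit.KontsevichZagierPeriods.Zeta5Search.StaircaseCells

/-! ## §0 Kit: `casLB` from a cover without the restriction `p ≤ d`; the ray's window facts; shifts in the polytope -/

/-- **`casLB` from a cover** (variant of `ClassTypeCover.casLB_ge_of_cover` keeping the no-pole alternative explicit and allowing `p > d` when
`B ≤ 0`): `A + B ≤ casLB b p`, or no class has a pole and `casLB b p = 0`. -/
theorem casLB_of_cover' {p : ℕ} [Fact p.Prime] {b : ℕ → ℤ} {TY : List (List ℤ × Bool)} (hcov : Cover b p TY) {A B : ℤ}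
    (hchk : checkLB (decide (¬ (2 : ℤ) ∣ b 0)) TY A B = true) (hB1 : B ≤ 1) (hB0 : dOf b < (p : ℤ) → B ≤ 0) :
    (casLB b p = 0 ∧ ∀ x, x < p → classPoleCount b p x = 0) ∨ A + B ≤ casLB b p := by
  rw [checkLB, List.all_eq_true] at hchk
  refine casLB_ge_or_noPole b p A B (fun x hx h1 => ?_) hB1 (fun x hx h2 => ?_) hB0
  · obtain ⟨tc, htc, ht⟩ := hcov x hx
    have hc := hchk tc htc
    simp only [Bool.and_eq_true, Bool.or_eq_true, decide_eq_true_eq] at hc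
    rw [ht.classPoleCount_eq] at h1
    rw [ht.classNu_eq]
    rcases hc.1 with h0 | hA
    · omega
    · exact hA
  · obtain ⟨tc, htc, ht⟩ := hcov x hx
    have hc := hchk tc htc
    simp only [Bool.and_eq_true, Bool.or_eq_true, decide_eq_true_eq] at hc
    rw [ht.classPoleCount_eq] at h2
    rw [ht.classExp_eq]
    rcases hc.2 with h0 | hB
    · omega
    · exact hB

/-- Every contiguous shift of the ray lies in the polytope (`n ≥ 1`). -/
theorem inPolytope_shift_ray_j {n : ℕ} (hn : 1 ≤ n) (j : ℕ) (hj1 : 1 ≤ j) (hj7 : j ≤ 7) :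
    InPolytope (shift (bRay [60, 25, 24, 22, 21, 19, 18, 16] n) j) := by
  have hs : ∀ i, shift (bRay [60, 25, 24, 22, 21, 19, 18, 16] n) j i =
      if i = j then bRay [60, 25, 24, 22, 21, 19, 18, 16] n j + 1 else bRay [60, 25, 24, 22, 21, 19, 18, 16] n i := by
    intro i; simp only [shift, Function.update_apply]
  interval_cases j <;>
  · refine ⟨⟨?_, ?_⟩, ?_, ?_⟩
    · rw [hs]; simp only [Nat.reduceEqDiff, if_false, v0]; positivity
    · intro i hi
      simp only [Finset.mem_range] at hi
      interval_cases i <;> simp only [hs, Nat.reduceAdd, Nat.reduceEqDiff, if_true, if_false, v0, v1, v2, v3, v4, v5, v6, v7] <;> omega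
    · intro i hi
      simp only [Finset.mem_range] at hi
      interval_cases i <;> simp only [hs, Nat.reduceAdd, Nat.reduceEqDiff, if_true, if_false, v0, v1, v2, v3, v4, v5, v6, v7] <;> omega
    · simp only [Finset.sum_range_succ, Finset.sum_range_zero, zero_add, Nat.reduceAdd, hs, Nat.reduceEqDiff, if_true, if_false,
        v0, v1, v2, v3, v4, v5, v6, v7]; omega

/-- Window facts for `13n < p` (`n ≥ 1`): `5 ≤ p` and `b₀ + 2 < p²`. -/
theorem window13 {n p : ℕ} (hn : 1 ≤ n) (h13 : 13 * n < p) :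
    5 ≤ p ∧ (bRay [60, 25, 24, 22, 21, 19, 18, 16] n 0 + 2 : ℤ) < (p : ℤ) ^ 2 := by
  refine ⟨by omega, ?_⟩
  rw [v0]
  have h14 : (13 * n + 1 : ℤ) ≤ p := by exact_mod_cast (show 13 * n + 1 ≤ p by omega)
  have hn1 : (1 : ℤ) ≤ n := by exact_mod_cast hn
  push_cast
  nlinarith

/-- `p ≤ d = 35n`. -/
theorem le_dOf_ray {n p : ℕ} (h : p ≤ 35 * n) : (p : ℤ) ≤ dOf (bRay [60, 25, 24, 22, 21, 19, 18, 16] n) := by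
  rw [dOf_ray]; exact_mod_cast h

/-- **THEOREM LB on the ray, any direction `j`**: `casLB(b(n),p) ≤ v_p(Cas_j(b(n)))` for `13n < p`. -/
theorem cas_ge_casLB {n j p : ℕ} (hn : 1 ≤ n) (hj1 : 1 ≤ j) (hj7 : j ≤ 7) (hprime : p.Prime) (h13 : 13 * n < p)
    (hcas : casoratian (bRay [60, 25, 24, 22, 21, 19, 18, 16] n) j ≠ 0) :
    casLB (bRay [60, 25, 24, 22, 21, 19, 18, 16] n) p ≤ padicValRat p (casoratian (bRay [60, 25, 24, 22, 21, 19, 18, 16] n) j) := by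
  obtain ⟨hp5, hwin⟩ := window13 hn h13
  exact casoratianClassBound_holds _ j p (inPolytope_ray n) hj1 hj7 (inPolytope_shift_ray_j hn j hj1 hj7) hprime hp5 hwin hcas

/-! ## §1 `casLB` cell by cell (from the covers) -/

section Cells
variable {n p : ℕ} [Fact p.Prime]

/-- `(13,14]`: `casLB ≥ −11`. -/
theorem casLB_c13 (hA : 26 * n < 2 * p) (hB : 2 * p ≤ 28 * n) (hp2 : p % 2 = 1) :
    (-11 : ℤ) ≤ casLB (bRay [60, 25, 24, 22, 21, 19, 18, 16] n) p := by
  rcases casLB_of_cover' (cover_c13 hA hB hp2) (checkM_c13 _) (by norm_num)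
    (fun h => absurd h (by rw [dOf_ray]; push_cast; omega)) with ⟨h0, -⟩ | h
  · rw [h0]; norm_num
  · linarith

/-- `(14,15]`: `casLB ≥ −9`. -/
theorem casLB_c14 (hA : 28 * n < 2 * p) (hB : 2 * p ≤ 30 * n) (hp2 : p % 2 = 1) :
    (-9 : ℤ) ≤ casLB (bRay [60, 25, 24, 22, 21, 19, 18, 16] n) p := by
  rcases casLB_of_cover' (cover_c14 hA hB hp2) (checkM_c14 _) (by norm_num)
    (fun h => absurd h (by rw [dOf_ray]; push_cast; omega)) with ⟨h0, -⟩ | h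
  · rw [h0]; norm_num
  · linarith

/-- `(15,16]`: `casLB ≥ −9`. -/
theorem casLB_c15 (hA : 30 * n < 2 * p) (hB : 2 * p ≤ 32 * n) (hp2 : p % 2 = 1) :
    (-9 : ℤ) ≤ casLB (bRay [60, 25, 24, 22, 21, 19, 18, 16] n) p := by
  rcases casLB_of_cover' (cover_c15 hA hB hp2) (checkM_c15 _) (by norm_num)
    (fun h => absurd h (by rw [dOf_ray]; push_cast; omega)) with ⟨h0, -⟩ | h
  · rw [h0]; norm_num
  · linarith

/-- `(16,17]`: `casLB ≥ −7`. -/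
theorem casLB_c16 (hA : 32 * n < 2 * p) (hB : 2 * p ≤ 34 * n) (hp2 : p % 2 = 1) :
    (-7 : ℤ) ≤ casLB (bRay [60, 25, 24, 22, 21, 19, 18, 16] n) p := by
  rcases casLB_of_cover' (cover_c16 hA hB hp2) (checkM_c16 _) (by norm_num)
    (fun h => absurd h (by rw [dOf_ray]; push_cast; omega)) with ⟨h0, -⟩ | h
  · rw [h0]; norm_num
  · linarith

/-- `(17,17.5]`: `casLB ≥ −6`. -/
theorem casLB_c17a (hA : 34 * n < 2 * p) (hB : 2 * p ≤ 35 * n) (hp2 : p % 2 = 1) :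
    (-6 : ℤ) ≤ casLB (bRay [60, 25, 24, 22, 21, 19, 18, 16] n) p := by
  rcases casLB_of_cover' (cover_c17a hA hB hp2) (checkM_c17a _) (by norm_num)
    (fun h => absurd h (by rw [dOf_ray]; push_cast; omega)) with ⟨h0, -⟩ | h
  · rw [h0]; norm_num
  · linarith

/-- `(17.5,18]`: `casLB ≥ −6`. -/
theorem casLB_c17b (hA : 35 * n < 2 * p) (hB : 2 * p ≤ 36 * n) (hp2 : p % 2 = 1) :
    (-6 : ℤ) ≤ casLB (bRay [60, 25, 24, 22, 21, 19, 18, 16] n) p := by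
  rcases casLB_of_cover' (cover_c17b hA hB hp2) (checkM_c17b _) (by norm_num)
    (fun h => absurd h (by rw [dOf_ray]; push_cast; omega)) with ⟨h0, -⟩ | h
  · rw [h0]; norm_num
  · linarith

/-- `(18,19]`: `casLB ≥ −6`. -/
theorem casLB_c18 (hA : 36 * n < 2 * p) (hB : 2 * p ≤ 38 * n) (hp2 : p % 2 = 1) :
    (-6 : ℤ) ≤ casLB (bRay [60, 25, 24, 22, 21, 19, 18, 16] n) p := by
  rcases casLB_of_cover' (cover_c18 hA hB hp2) (checkM_c18 _) (by norm_num)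
    (fun h => absurd h (by rw [dOf_ray]; push_cast; omega)) with ⟨h0, -⟩ | h
  · rw [h0]; norm_num
  · linarith

/-- `(19,20]`: `casLB ≥ −5`. -/
theorem casLB_c19 (hA : 38 * n < 2 * p) (hB : 2 * p ≤ 40 * n) (hp2 : p % 2 = 1) :
    (-5 : ℤ) ≤ casLB (bRay [60, 25, 24, 22, 21, 19, 18, 16] n) p := by
  rcases casLB_of_cover' (cover_c19 hA hB hp2) (checkM_c19 _) (by norm_num)
    (fun h => absurd h (by rw [dOf_ray]; push_cast; omega)) with ⟨h0, -⟩ | h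
  · rw [h0]; norm_num
  · linarith

/-- `(20,21]`: `casLB ≥ −5`. -/
theorem casLB_c20 (hA : 40 * n < 2 * p) (hB : 2 * p ≤ 42 * n) (hp2 : p % 2 = 1) :
    (-5 : ℤ) ≤ casLB (bRay [60, 25, 24, 22, 21, 19, 18, 16] n) p := by
  rcases casLB_of_cover' (cover_c20 hA hB hp2) (checkM_c20 _) (by norm_num)
    (fun h => absurd h (by rw [dOf_ray]; push_cast; omega)) with ⟨h0, -⟩ | h
  · rw [h0]; norm_num
  · linarith

/-- `(22,23]`: `casLB ≥ −3`. -/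
theorem casLB_c22 (hA : 44 * n < 2 * p) (hB : 2 * p ≤ 46 * n) (hp2 : p % 2 = 1) :
    (-3 : ℤ) ≤ casLB (bRay [60, 25, 24, 22, 21, 19, 18, 16] n) p := by
  rcases casLB_of_cover' (cover_c22 hA hB hp2) (checkM_c22 _) (by norm_num)
    (fun h => absurd h (by rw [dOf_ray]; push_cast; omega)) with ⟨h0, -⟩ | h
  · rw [h0]; norm_num
  · linarith

/-- `(23,25]`: `casLB ≥ −1`. -/
theorem casLB_c23 (hA : 46 * n < 2 * p) (hB : 2 * p ≤ 50 * n) (hp2 : p % 2 = 1) :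
    (-1 : ℤ) ≤ casLB (bRay [60, 25, 24, 22, 21, 19, 18, 16] n) p := by
  rcases casLB_of_cover' (cover_c23 hA hB hp2) (checkM_c23 _) (by norm_num)
    (fun h => absurd h (by rw [dOf_ray]; push_cast; omega)) with ⟨h0, -⟩ | h
  · rw [h0]; norm_num
  · linarith

/-- `(25,26]`: `casLB ≥ 0`. -/
theorem casLB_c25 (hA : 50 * n < 2 * p) (hB : 2 * p ≤ 52 * n) (hp2 : p % 2 = 1) :
    (0 : ℤ) ≤ casLB (bRay [60, 25, 24, 22, 21, 19, 18, 16] n) p := by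
  rcases casLB_of_cover' (cover_c25 hA hB hp2) (checkM_c25 _) (by norm_num)
    (fun h => absurd h (by rw [dOf_ray]; push_cast; omega)) with ⟨h0, -⟩ | h
  · rw [h0]
  · linarith

/-- `(26,35]`: `casLB ≥ 1` (the class of `18n` — type `[−1, 1]` — has a pole, so the no-pole alternative is excluded). -/
theorem casLB_c26 (hA : 52 * n < 2 * p) (hB : 2 * p ≤ 70 * n) (hp2 : p % 2 = 1) :
    (1 : ℤ) ≤ casLB (bRay [60, 25, 24, 22, 21, 19, 18, 16] n) p := by
  rcases casLB_of_cover' (cover_c26 hA hB hp2) (checkM_c26 _) (by norm_num)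
    (fun h => absurd h (by rw [dOf_ray]; push_cast; omega)) with ⟨-, h0⟩ | h
  · exfalso
    have ht := iv_c26_12 (n := n) (p := p) (x := 18 * n) hA hB (by omega) (by omega) (by omega) (by omega) (by omega) (by omega)
    have h1 := h0 (18 * n) (by omega)
    rw [ht.classPoleCount_eq] at h1
    revert h1; decide
  · linarith

/-- `(35,60]` (`p > d`): `casLB ≥ 0`. -/
theorem casLB_c35 (hA : 70 * n < 2 * p) (hB : 2 * p ≤ 120 * n) (hp2 : p % 2 = 1) :
    (0 : ℤ) ≤ casLB (bRay [60, 25, 24, 22, 21, 19, 18, 16] n) p := by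
  rcases casLB_of_cover' (cover_c35 hA hB hp2) (checkM_c35 _) (by norm_num) (fun _ => le_rfl) with ⟨h0, -⟩ | h
  · rw [h0]
  · linarith

end Cells

/-- Beyond the support (`p > 60n = b₀`) every class is at most the singleton `{x}`: a pole class is a tame single pole (`ν ≥ 0`), there is no
multipole class and `p > d`, so `casLB(b(n),p) ≥ 0` (the record ray's `casLB_bRec_nonneg_gt41`, verbatim for this ray). -/
theorem casLB_gt60 {n p : ℕ} (hp : 60 * n < p) : 0 ≤ casLB (bRay [60, 25, 24, 22, 21, 19, 18, 16] n) p := by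
  have hsub : ∀ x, x < p → ∀ s ∈ classSet (bRay [60, 25, 24, 22, 21, 19, 18, 16] n) p x, s = x := by
    intro x hx s hs
    rw [mem_classSet_iff, zero_toNat] at hs
    obtain ⟨hs60, k, hk⟩ := hs
    have hk0 : 0 ≤ k := by
      by_contra hneg
      push Not at hneg
      have : (p : ℤ) * k ≤ (p : ℤ) * (-1) := mul_le_mul_of_nonneg_left (by omega) (by omega)
      omega
    have hk1 : k < 1 := by
      by_contra hge
      push Not at hge
      have : (p : ℤ) * 1 ≤ (p : ℤ) * k := mul_le_mul_of_nonneg_left hge (by omega)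
      omega
    interval_cases k
    omega
  have hle : ∀ x, x < p → classPoleCount (bRay [60, 25, 24, 22, 21, 19, 18, 16] n) p x ≤ 1 := by
    intro x hx
    unfold classPoleCount
    calc ((classSet (bRay [60, 25, 24, 22, 21, 19, 18, 16] n) p x).filter fun s => netExp (bRay [60, 25, 24, 22, 21, 19, 18, 16] n) s < 0).card
        ≤ ({x} : Finset ℕ).card := card_le_card fun s hs => mem_singleton.2 (hsub x hx s (mem_filter.1 hs).1)
      _ = 1 := card_singleton x
  have hA : ∀ x, x < p → 1 ≤ classPoleCount (bRay [60, 25, 24, 22, 21, 19, 18, 16] n) p x →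
      (0 : ℤ) ≤ classNu (bRay [60, 25, 24, 22, 21, 19, 18, 16] n) p x := by
    intro x hx h1
    have hc : classPoleCount (bRay [60, 25, 24, 22, 21, 19, 18, 16] n) p x = 1 := le_antisymm (hle x hx) h1
    obtain ⟨s, hs⟩ : ((classSet (bRay [60, 25, 24, 22, 21, 19, 18, 16] n) p x).filter
        fun s => netExp (bRay [60, 25, 24, 22, 21, 19, 18, 16] n) s < 0).Nonempty := by
      rw [← card_pos]; unfold classPoleCount at h1; exact h1
    obtain ⟨hsx, hneg⟩ := mem_filter.1 hs
    obtain rfl := hsub x hx s hsx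
    have htm : tameSingle (bRay [60, 25, 24, 22, 21, 19, 18, 16] n) p s = true := by
      rw [tameSingle_iff]; exact ⟨s, hsx, hneg, Or.inl hx⟩
    unfold classNu; rw [if_pos ⟨hc, htm⟩]; exact le_max_right _ _
  rcases casLB_ge_or_noPole (bRay [60, 25, 24, 22, 21, 19, 18, 16] n) p 0 0 hA (by norm_num)
      (fun x hx h2 => absurd (hle x hx) (by omega)) (fun _ => le_rfl) with ⟨h0, -⟩ | h
  · rw [h0]
  · linarith

end Summit.KontsevichZagierPeriods.Zeta5Search.StairFLAG
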